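import Literature.InformationTheory.QuantumCodes.DrawnCheckMatrixCountingBound
import HarnessLib

/-!
# Transport of a drawn check matrix along re-indexings of its checks and locations (code equivalences) and along equalities
# of matrices: the drawing, the height gap and the bottom crossing number are invariant

Topic `Literature/InformationTheory/QuantumCodes` (venture QEC, LADDER-QEC rung Q5, PARTITION row 09; qec-type-09 gen 7, line D50.L6
«L-PHENOM», generic part). All PROVED, kernel axioms, no named fact. A permutation-equivalent presentation of a check matrix
(`Matrix.reindex eX eΛ M`; Lin–Pryadko: permutation-equivalent codes have the same parameters and decoding problem) inherits
every drawing of `M` on `ℤ^d` (`DrawnCheckMatrixCrossingPaths.lean`) with the same sites, bonds and rough edges; so does a matrix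
EQUAL to `M` (e.g. the `Z`-checks of the planar surface code, which ARE the re-indexed `X`-checks). This lets the second sector
of a self-dual surface code reuse the first sector's drawing instead of a second geometric argument.

* `CheckDrawing.reindex Δ eX eΛ : CheckDrawing (Matrix.reindex eX eΛ M) d B Tt`, `CheckDrawing.ofEq Δ (h : M' = M)`;
* `reindex_heightGap`, `ofEq_heightGap` — the height gap is unchanged (same virtual sites);
* `sum_mul_bot_reindex`, `sum_mul_bot_ofEq` — the bottom crossing number of a chain on the re-indexed locations is that of the
  pulled-back chain.

## References

* [LinPryadko2024] H.-K. Lin, L. P. Pryadko, PRA 109 (2024) 022407, §4.2 Thm 6 (permutation-equivalent codes).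
* [DennisEtAl2002] E. Dennis, A. Kitaev, A. Landahl, J. Preskill, J. Math. Phys. 43 (2002) 4452, §3.2 (rough edges), §4.1 (the
  two error types are treated alike on the dual lattice).
-/

namespace Literature.InformationTheory.QuantumCodes

namespace CheckDrawing

open Finset Matrix
open Literature.Probability.LatticeModels (Site)

variable {X Λ X' Λ' B Tt : Type*} {d : ℕ} {M : Matrix X Λ (ZMod 2)}

/-- **Re-indexing a drawing**: the drawing of `Matrix.reindex eX eΛ M` with the site of `x'` = the site of `eX⁻¹ x'`, the bond of
`ℓ'` = the bond of `eΛ⁻¹ ℓ'`, the same virtual sites and `bot ℓ' = bot (eΛ⁻¹ ℓ')`.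
[cite: LinPryadko2024, §4.2 Thm 6 (permutation-equivalent codes)] -/
def reindex (Δ : CheckDrawing M d B Tt) (eX : X ≃ X') (eΛ : Λ ≃ Λ') :
    CheckDrawing (Matrix.reindex eX eΛ M) d B Tt where
  site x := Δ.site (eX.symm x)
  bond ℓ := Δ.bond (eΛ.symm ℓ)
  vb := Δ.vb
  vt := Δ.vt
  bot ℓ := Δ.bot (eΛ.symm ℓ)
  site_injective := Δ.site_injective.comp eX.symm.injective
  bond_injective := Δ.bond_injective.comp eΛ.symm.injective
  adj_of_bond_eq ℓ P P' h := Δ.adj_of_bond_eq _ P P' h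
  apply_eq_ite x ℓ := by
    rw [Matrix.reindex_apply, Matrix.submatrix_apply]
    exact Δ.apply_eq_ite _ _
  site_ne_vb x b := Δ.site_ne_vb _ b
  site_ne_vt x t := Δ.site_ne_vt _ t
  vb_ne_vt := Δ.vb_ne_vt
  ends_cases ℓ P hP := by
    rcases Δ.ends_cases _ P hP with ⟨x, hx⟩ | h | h
    · exact Or.inl ⟨eX x, by rw [Equiv.symm_apply_apply]; exact hx⟩
    · exact Or.inr (Or.inl h)
    · exact Or.inr (Or.inr h)
  bot_eq ℓ P P' h := Δ.bot_eq _ P P' h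

/-- **Transport along an equality of matrices** (same drawing). [cite: LinPryadko2024, §4.2 Thm 6] -/
def ofEq (Δ : CheckDrawing M d B Tt) {M' : Matrix X Λ (ZMod 2)} (h : M' = M) : CheckDrawing M' d B Tt where
  site := Δ.site
  bond := Δ.bond
  vb := Δ.vb
  vt := Δ.vt
  bot := Δ.bot
  site_injective := Δ.site_injective
  bond_injective := Δ.bond_injective
  adj_of_bond_eq := Δ.adj_of_bond_eq
  apply_eq_ite x ℓ := by rw [h]; exact Δ.apply_eq_ite x ℓ
  site_ne_vb := Δ.site_ne_vb
  site_ne_vt := Δ.site_ne_vt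
  vb_ne_vt := Δ.vb_ne_vt
  ends_cases := Δ.ends_cases
  bot_eq := Δ.bot_eq

/-- The height gap is unchanged by re-indexing (same virtual sites). [cite: DennisEtAl2002, §5.2 (H ≥ L)] -/
theorem reindex_heightGap (Δ : CheckDrawing M d B Tt) (eX : X ≃ X') (eΛ : Λ ≃ Λ') {n₀ : ℕ} (h : Δ.HeightGap n₀) :
    (Δ.reindex eX eΛ).HeightGap n₀ := h

/-- The height gap is unchanged by transport along an equality. [cite: DennisEtAl2002, §5.2 (H ≥ L)] -/
theorem ofEq_heightGap (Δ : CheckDrawing M d B Tt) {M' : Matrix X Λ (ZMod 2)} (hM : M' = M) {n₀ : ℕ} (h : Δ.HeightGap n₀) :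
    (Δ.ofEq hM).HeightGap n₀ := h

/-- **The bottom crossing number of a chain on the re-indexed locations is that of the pulled-back chain**:
`Σ_{ℓ'} c(ℓ')·bot'(ℓ') = Σ_ℓ c(eΛ ℓ)·bot(ℓ)`. [cite: LinPryadko2024, §4.2 Thm 6] -/
theorem sum_mul_bot_reindex [Fintype Λ] [Fintype Λ'] (Δ : CheckDrawing M d B Tt) (eX : X ≃ X') (eΛ : Λ ≃ Λ')
    (c : Λ' → ZMod 2) : ∑ ℓ, c ℓ * (Δ.reindex eX eΛ).bot ℓ = ∑ ℓ, c (eΛ ℓ) * Δ.bot ℓ := by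
  refine Fintype.sum_equiv eΛ.symm _ _ fun ℓ => ?_
  simp only [reindex, Equiv.apply_symm_apply]

/-- The bottom crossing number is unchanged by transport along an equality. [cite: LinPryadko2024, §4.2 Thm 6] -/
theorem sum_mul_bot_ofEq [Fintype Λ] (Δ : CheckDrawing M d B Tt) {M' : Matrix X Λ (ZMod 2)} (hM : M' = M)
    (c : Λ → ZMod 2) : ∑ ℓ, c ℓ * (Δ.ofEq hM).bot ℓ = ∑ ℓ, c ℓ * Δ.bot ℓ := rfl

end CheckDrawing

end Literature.InformationTheory.QuantumCodes
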